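import Literature.NumberTheory.LFunctions.WeilPositivityCertificate
import HarnessLib

/-!
# Rational Maclaurin brackets of `cos(hL)` and `sin(hL)` with an interval frequency

Kernel-checkable ingredients for certified minorants of rippled weights such as the first-prime
Weil weight `w₂(t) = Re ψ(1/4 + it/2) − √2 log 2 cos(t log 2)` (`WeilFirstPrimeCells.lean`,
`WeilFirstPrimeQuadratic.lean`): for a frequency `L` known only through rationals
`0 ≤ Llo ≤ L ≤ Lhi` and `0 ≤ h` with `hL ≤ 1`,

* `polyR cs h = Σ cs_k h^k` for a rational coefficient list (`polyR_tabV`, `abs_polyR_le`);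
* `reIpowQ`, `imIpowQ` (`Re/Im (I^k)` as rationals) and the Maclaurin remainder bounds
  `abs_cos_sub_sum_le`, `abs_sin_sub_sum_le` (`|cos y − Σ_{k<n} Re(I^k) y^k/k!| ≤ |y|^n (n+1)/(n! n)`
  on `|y| ≤ 1`, from `Complex.exp_bound` at `x = iy`);
* the coefficient lists `cosLoCoeffs`, `cosUpCoeffs`, `sinLoCoeffs`, `sinUpCoeffs` (monomials
  bracketed in `L`, remainder as the top coefficient) with soundness `polyR_cosLo_le`,
  `cos_le_polyR_cosUp`, `polyR_sinLo_le`, `sin_le_polyR_sinUp`.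

Everything here is proved; there are no named facts.

## References

* R. E. Moore, *Interval Analysis* (1966), Ch. 3 (interval extensions of elementary functions).
-/

noncomputable section

open Complex Finset MeasureTheory Set Filter
open scoped Real Topology BigOperators

namespace Literature.NumberTheory.LFunctions


/-! ## Rational polynomials -/

/-- `P(h) = Σ_{k < |cs|} cs_k h^k` for a rational coefficient list. [folklore] -/
def polyR (cs : List ℚ) (h : ℝ) : ℝ :=
  ∑ k ∈ Finset.range cs.length, ((getV cs k : ℚ) : ℝ) * h ^ k

/-- `polyR` of a tabulated list is the plain finite sum. [folklore] -/
theorem polyR_tabV (n : ℕ) (f : ℕ → ℚ) (h : ℝ) :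
    polyR (tabV n f) h = ∑ k ∈ Finset.range n, ((f k : ℚ) : ℝ) * h ^ k := by
  unfold polyR
  have hlen : (tabV n f).length = n := by simp [tabV]
  rw [hlen]
  refine Finset.sum_congr rfl fun k hk ↦ ?_
  rw [getV_tabV f (Finset.mem_range.1 hk)]

/-- `|P(h)| ≤ Σ |cs_k| w^k` for `0 ≤ h ≤ w`. [folklore] -/
theorem abs_polyR_le (cs : List ℚ) {h w : ℝ} (h0 : 0 ≤ h) (hw : h ≤ w) :
    |polyR cs h| ≤ ∑ k ∈ Finset.range cs.length, |((getV cs k : ℚ) : ℝ)| * w ^ k := by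
  unfold polyR
  refine (Finset.abs_sum_le_sum_abs _ _).trans (Finset.sum_le_sum fun k _ ↦ ?_)
  rw [abs_mul, abs_pow, abs_of_nonneg h0]
  exact mul_le_mul_of_nonneg_left (pow_le_pow_left₀ h0 hw k) (abs_nonneg _)

/-! ## Real and imaginary parts of `I^k` -/

/-- `Re(I^k)` as a rational: `1, 0, −1, 0, …`. [folklore] -/
def reIpowQ (k : ℕ) : ℚ := if k % 4 = 0 then 1 else if k % 4 = 2 then -1 else 0

/-- `Im(I^k)` as a rational: `0, 1, 0, −1, …`. [folklore] -/
def imIpowQ (k : ℕ) : ℚ := if k % 4 = 1 then 1 else if k % 4 = 3 then -1 else 0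

/-- `Re(I^k) = reIpowQ k`. [folklore] -/
theorem re_I_pow (k : ℕ) : (Complex.I ^ k).re = ((reIpowQ k : ℚ) : ℝ) := by
  rw [Complex.I_pow_eq_pow_mod, reIpowQ]
  have hk : k % 4 < 4 := Nat.mod_lt _ (by norm_num)
  interval_cases h : k % 4 <;> simp [pow_succ]

/-- `Im(I^k) = imIpowQ k`. [folklore] -/
theorem im_I_pow (k : ℕ) : (Complex.I ^ k).im = ((imIpowQ k : ℚ) : ℝ) := by
  rw [Complex.I_pow_eq_pow_mod, imIpowQ]
  have hk : k % 4 < 4 := Nat.mod_lt _ (by norm_num)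
  interval_cases h : k % 4 <;> simp [pow_succ]

/-! ## Maclaurin remainders of `cos` and `sin` on `[-1, 1]` -/

/-- The Maclaurin remainder constant `(n+1)/(n!·n)` as a rational. [folklore] -/
def expRemQ (n : ℕ) : ℚ := (n + 1) / (n.factorial * n)

/-- `|cos y − Σ_{k<n} Re(I^k) y^k/k!| ≤ |y|^n (n+1)/(n! n)` for `|y| ≤ 1` (`Complex.exp_bound` at
`x = iy`, real part). [folklore] -/
theorem abs_cos_sub_sum_le {y : ℝ} (hy : |y| ≤ 1) {n : ℕ} (hn : 0 < n) :
    |Real.cos y - ∑ k ∈ Finset.range n, ((reIpowQ k : ℚ) : ℝ) * y ^ k / k.factorial| ≤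
      |y| ^ n * ((expRemQ n : ℚ) : ℝ) := by
  have hx : ‖(y : ℂ) * I‖ ≤ 1 := by rw [Complex.norm_mul, Complex.norm_I, mul_one, Complex.norm_real, Real.norm_eq_abs]; exact hy
  have h := Complex.exp_bound hx hn
  have hre : (Complex.exp ((y : ℂ) * I) - ∑ m ∈ Finset.range n, ((y : ℂ) * I) ^ m / m.factorial).re =
      Real.cos y - ∑ k ∈ Finset.range n, ((reIpowQ k : ℚ) : ℝ) * y ^ k / k.factorial := by
    rw [Complex.sub_re, Complex.exp_ofReal_mul_I_re, Complex.re_sum]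
    congr 1
    refine Finset.sum_congr rfl fun m _ ↦ ?_
    have e : ((y : ℂ) * I) ^ m / (m.factorial : ℂ) = ((y ^ m / m.factorial : ℝ) : ℂ) * I ^ m := by
      push_cast; rw [mul_pow]; ring
    rw [e, Complex.re_ofReal_mul, re_I_pow]
    ring
  have hnorm : ‖(y : ℂ) * I‖ = |y| := by
    rw [Complex.norm_mul, Complex.norm_I, mul_one, Complex.norm_real, Real.norm_eq_abs]
  rw [← hre]
  refine (Complex.abs_re_le_norm _).trans (h.trans (le_of_eq ?_))
  rw [hnorm, expRemQ]
  push_cast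
  ring

/-- `|sin y − Σ_{k<n} Im(I^k) y^k/k!| ≤ |y|^n (n+1)/(n! n)` for `|y| ≤ 1`. [folklore] -/
theorem abs_sin_sub_sum_le {y : ℝ} (hy : |y| ≤ 1) {n : ℕ} (hn : 0 < n) :
    |Real.sin y - ∑ k ∈ Finset.range n, ((imIpowQ k : ℚ) : ℝ) * y ^ k / k.factorial| ≤
      |y| ^ n * ((expRemQ n : ℚ) : ℝ) := by
  have hx : ‖(y : ℂ) * I‖ ≤ 1 := by rw [Complex.norm_mul, Complex.norm_I, mul_one, Complex.norm_real, Real.norm_eq_abs]; exact hy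
  have h := Complex.exp_bound hx hn
  have him : (Complex.exp ((y : ℂ) * I) - ∑ m ∈ Finset.range n, ((y : ℂ) * I) ^ m / m.factorial).im =
      Real.sin y - ∑ k ∈ Finset.range n, ((imIpowQ k : ℚ) : ℝ) * y ^ k / k.factorial := by
    rw [Complex.sub_im, Complex.exp_ofReal_mul_I_im, Complex.im_sum]
    congr 1
    refine Finset.sum_congr rfl fun m _ ↦ ?_
    have e : ((y : ℂ) * I) ^ m / (m.factorial : ℂ) = ((y ^ m / m.factorial : ℝ) : ℂ) * I ^ m := by
      push_cast; rw [mul_pow]; ring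
    rw [e, Complex.im_ofReal_mul, im_I_pow]
    ring
  have hnorm : ‖(y : ℂ) * I‖ = |y| := by
    rw [Complex.norm_mul, Complex.norm_I, mul_one, Complex.norm_real, Real.norm_eq_abs]
  rw [← him]
  refine (Complex.abs_im_le_norm _).trans (h.trans (le_of_eq ?_))
  rw [hnorm, expRemQ]
  push_cast
  ring

/-! ## Rational polynomial brackets of `cos(hL)`, `sin(hL)` for `L ∈ [Llo, Lhi]`, `0 ≤ hL ≤ 1` -/

/-- Coefficient list (length `n+1`) of a LOWER bound of `cos(hL)` in powers of `h`. [folklore] -/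
def cosLoCoeffs (Llo Lhi : ℚ) (n : ℕ) : List ℚ :=
  tabV (n + 1) fun k ↦
    if k < n then (if 0 ≤ reIpowQ k then reIpowQ k * Llo ^ k / k.factorial
      else reIpowQ k * Lhi ^ k / k.factorial)
    else -(Lhi ^ n * expRemQ n)

/-- Coefficient list of an UPPER bound of `cos(hL)`. [folklore] -/
def cosUpCoeffs (Llo Lhi : ℚ) (n : ℕ) : List ℚ :=
  tabV (n + 1) fun k ↦
    if k < n then (if 0 ≤ reIpowQ k then reIpowQ k * Lhi ^ k / k.factorial
      else reIpowQ k * Llo ^ k / k.factorial)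
    else Lhi ^ n * expRemQ n

/-- Coefficient list of a LOWER bound of `sin(hL)`. [folklore] -/
def sinLoCoeffs (Llo Lhi : ℚ) (n : ℕ) : List ℚ :=
  tabV (n + 1) fun k ↦
    if k < n then (if 0 ≤ imIpowQ k then imIpowQ k * Llo ^ k / k.factorial
      else imIpowQ k * Lhi ^ k / k.factorial)
    else -(Lhi ^ n * expRemQ n)

/-- Coefficient list of an UPPER bound of `sin(hL)`. [folklore] -/
def sinUpCoeffs (Llo Lhi : ℚ) (n : ℕ) : List ℚ :=
  tabV (n + 1) fun k ↦
    if k < n then (if 0 ≤ imIpowQ k then imIpowQ k * Lhi ^ k / k.factorial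
      else imIpowQ k * Llo ^ k / k.factorial)
    else Lhi ^ n * expRemQ n

section TrigBrackets

variable {Llo Lhi : ℚ} {L h : ℝ} {n : ℕ}

/-- Monomial bracket: for `0 ≤ Llo ≤ L ≤ Lhi`, `0 ≤ h` and a rational sign `r`,
`(r ≥ 0 ? r Llo^k : r Lhi^k) h^k ≤ r (hL)^k`. [folklore] -/
theorem pick_lo_mul_le (hL0 : (0 : ℝ) ≤ Llo) (hL1 : (Llo : ℝ) ≤ L) (hL2 : L ≤ Lhi) (hh : 0 ≤ h)
    (r : ℚ) (k : ℕ) (d : ℕ) :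
    (((if 0 ≤ r then r * Llo ^ k / d else r * Lhi ^ k / d : ℚ) : ℚ) : ℝ) * h ^ k ≤
      (r : ℝ) * (h * L) ^ k / d := by
  have hLk1 : (Llo : ℝ) ^ k ≤ L ^ k := pow_le_pow_left₀ hL0 hL1 k
  have hLk2 : L ^ k ≤ (Lhi : ℝ) ^ k := pow_le_pow_left₀ (hL0.trans hL1) hL2 k
  have hhk : 0 ≤ h ^ k := pow_nonneg hh k
  rcases Nat.eq_zero_or_pos d with rfl | hd
  · simp
  have hd' : (0 : ℝ) < d := by exact_mod_cast hd
  split_ifs with hr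
  · push_cast
    rw [mul_pow, show (r : ℝ) * Llo ^ k / d * h ^ k = (r / d * h ^ k) * Llo ^ k by ring,
      show (r : ℝ) * (h ^ k * L ^ k) / d = (r / d * h ^ k) * L ^ k by ring]
    exact mul_le_mul_of_nonneg_left hLk1 (by have h0r : (0:ℝ) ≤ r := (by exact_mod_cast hr); positivity)
  · push Not at hr
    push_cast
    rw [mul_pow, show (r : ℝ) * Lhi ^ k / d * h ^ k = (r / d * h ^ k) * Lhi ^ k by ring,
      show (r : ℝ) * (h ^ k * L ^ k) / d = (r / d * h ^ k) * L ^ k by ring]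
    have : (r : ℝ) / d * h ^ k ≤ 0 :=
      mul_nonpos_of_nonpos_of_nonneg (div_nonpos_of_nonpos_of_nonneg (by exact_mod_cast hr.le) hd'.le) hhk
    exact mul_le_mul_of_nonpos_left hLk2 this

/-- Monomial bracket, upper version: `r (hL)^k ≤ (r ≥ 0 ? r Lhi^k : r Llo^k) h^k`. [folklore] -/
theorem le_pick_hi_mul (hL0 : (0 : ℝ) ≤ Llo) (hL1 : (Llo : ℝ) ≤ L) (hL2 : L ≤ Lhi) (hh : 0 ≤ h)
    (r : ℚ) (k : ℕ) (d : ℕ) :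
    (r : ℝ) * (h * L) ^ k / d ≤
      (((if 0 ≤ r then r * Lhi ^ k / d else r * Llo ^ k / d : ℚ) : ℚ) : ℝ) * h ^ k := by
  have hLk1 : (Llo : ℝ) ^ k ≤ L ^ k := pow_le_pow_left₀ hL0 hL1 k
  have hLk2 : L ^ k ≤ (Lhi : ℝ) ^ k := pow_le_pow_left₀ (hL0.trans hL1) hL2 k
  have hhk : 0 ≤ h ^ k := pow_nonneg hh k
  rcases Nat.eq_zero_or_pos d with rfl | hd
  · simp
  have hd' : (0 : ℝ) < d := by exact_mod_cast hd
  split_ifs with hr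
  · push_cast
    rw [mul_pow, show (r : ℝ) * Lhi ^ k / d * h ^ k = (r / d * h ^ k) * Lhi ^ k by ring,
      show (r : ℝ) * (h ^ k * L ^ k) / d = (r / d * h ^ k) * L ^ k by ring]
    exact mul_le_mul_of_nonneg_left hLk2 (by have h0r : (0:ℝ) ≤ r := (by exact_mod_cast hr); positivity)
  · push Not at hr
    push_cast
    rw [mul_pow, show (r : ℝ) * Llo ^ k / d * h ^ k = (r / d * h ^ k) * Llo ^ k by ring,
      show (r : ℝ) * (h ^ k * L ^ k) / d = (r / d * h ^ k) * L ^ k by ring]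
    have : (r : ℝ) / d * h ^ k ≤ 0 :=
      mul_nonpos_of_nonpos_of_nonneg (div_nonpos_of_nonpos_of_nonneg (by exact_mod_cast hr.le) hd'.le) hhk
    exact mul_le_mul_of_nonpos_left hLk1 this

/-- The remainder monomial: `|hL|^n · rem ≤ Lhi^n rem · h^n`. [folklore] -/
theorem abs_pow_mul_rem_le (hL0 : (0 : ℝ) ≤ Llo) (hL1 : (Llo : ℝ) ≤ L) (hL2 : L ≤ Lhi) (hh : 0 ≤ h)
    (n : ℕ) : |h * L| ^ n * ((expRemQ n : ℚ) : ℝ) ≤ ((Lhi ^ n * expRemQ n : ℚ) : ℝ) * h ^ n := by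
  have hL : 0 ≤ L := hL0.trans hL1
  have hrem : (0 : ℝ) ≤ expRemQ n := by unfold expRemQ; positivity
  rw [abs_of_nonneg (mul_nonneg hh hL), mul_pow]
  push_cast
  rw [show ((Lhi : ℝ) ^ n * expRemQ n) * h ^ n = h ^ n * Lhi ^ n * expRemQ n by ring]
  exact mul_le_mul_of_nonneg_right (mul_le_mul_of_nonneg_left (pow_le_pow_left₀ hL hL2 n) (pow_nonneg hh n)) hrem

/-- **Lower bracket of `cos`.** [folklore] -/
theorem polyR_cosLo_le (hL0 : (0 : ℝ) ≤ Llo) (hL1 : (Llo : ℝ) ≤ L) (hL2 : L ≤ Lhi) (hh : 0 ≤ h)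
    (hhL : h * L ≤ 1) (hn : 0 < n) :
    polyR (cosLoCoeffs Llo Lhi n) h ≤ Real.cos (h * L) := by
  have hy : |h * L| ≤ 1 := by rw [abs_of_nonneg (mul_nonneg hh (hL0.trans hL1))]; exact hhL
  have hmain := abs_cos_sub_sum_le hy hn
  rw [abs_le] at hmain
  unfold cosLoCoeffs
  rw [polyR_tabV, Finset.sum_range_succ]
  have h1 : ∑ k ∈ Finset.range n,
      (((if k < n then (if 0 ≤ reIpowQ k then reIpowQ k * Llo ^ k / k.factorial
        else reIpowQ k * Lhi ^ k / k.factorial) else -(Lhi ^ n * expRemQ n) : ℚ) : ℚ) : ℝ) * h ^ k ≤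
      ∑ k ∈ Finset.range n, ((reIpowQ k : ℚ) : ℝ) * (h * L) ^ k / k.factorial := by
    refine Finset.sum_le_sum fun k hk ↦ ?_
    rw [if_pos (Finset.mem_range.1 hk)]
    exact pick_lo_mul_le hL0 hL1 hL2 hh (reIpowQ k) k k.factorial
  have h2 : (((if n < n then (if 0 ≤ reIpowQ n then reIpowQ n * Llo ^ n / n.factorial
        else reIpowQ n * Lhi ^ n / n.factorial) else -(Lhi ^ n * expRemQ n) : ℚ) : ℚ) : ℝ) * h ^ n ≤
      -(|h * L| ^ n * ((expRemQ n : ℚ) : ℝ)) := by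
    rw [if_neg (lt_irrefl n)]
    have := abs_pow_mul_rem_le hL0 hL1 hL2 hh n
    push_cast at this ⊢
    linarith
  linarith [hmain.1]

/-- **Upper bracket of `cos`.** [folklore] -/
theorem cos_le_polyR_cosUp (hL0 : (0 : ℝ) ≤ Llo) (hL1 : (Llo : ℝ) ≤ L) (hL2 : L ≤ Lhi) (hh : 0 ≤ h)
    (hhL : h * L ≤ 1) (hn : 0 < n) :
    Real.cos (h * L) ≤ polyR (cosUpCoeffs Llo Lhi n) h := by
  have hy : |h * L| ≤ 1 := by rw [abs_of_nonneg (mul_nonneg hh (hL0.trans hL1))]; exact hhL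
  have hmain := abs_cos_sub_sum_le hy hn
  rw [abs_le] at hmain
  unfold cosUpCoeffs
  rw [polyR_tabV, Finset.sum_range_succ]
  have h1 : ∑ k ∈ Finset.range n, ((reIpowQ k : ℚ) : ℝ) * (h * L) ^ k / k.factorial ≤
      ∑ k ∈ Finset.range n,
      (((if k < n then (if 0 ≤ reIpowQ k then reIpowQ k * Lhi ^ k / k.factorial
        else reIpowQ k * Llo ^ k / k.factorial) else Lhi ^ n * expRemQ n : ℚ) : ℚ) : ℝ) * h ^ k := by
    refine Finset.sum_le_sum fun k hk ↦ ?_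
    rw [if_pos (Finset.mem_range.1 hk)]
    exact le_pick_hi_mul hL0 hL1 hL2 hh (reIpowQ k) k k.factorial
  have h2 : |h * L| ^ n * ((expRemQ n : ℚ) : ℝ) ≤
      (((if n < n then (if 0 ≤ reIpowQ n then reIpowQ n * Lhi ^ n / n.factorial
        else reIpowQ n * Llo ^ n / n.factorial) else Lhi ^ n * expRemQ n : ℚ) : ℚ) : ℝ) * h ^ n := by
    rw [if_neg (lt_irrefl n)]
    exact abs_pow_mul_rem_le hL0 hL1 hL2 hh n
  linarith [hmain.2]

/-- **Lower bracket of `sin`.** [folklore] -/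
theorem polyR_sinLo_le (hL0 : (0 : ℝ) ≤ Llo) (hL1 : (Llo : ℝ) ≤ L) (hL2 : L ≤ Lhi) (hh : 0 ≤ h)
    (hhL : h * L ≤ 1) (hn : 0 < n) :
    polyR (sinLoCoeffs Llo Lhi n) h ≤ Real.sin (h * L) := by
  have hy : |h * L| ≤ 1 := by rw [abs_of_nonneg (mul_nonneg hh (hL0.trans hL1))]; exact hhL
  have hmain := abs_sin_sub_sum_le hy hn
  rw [abs_le] at hmain
  unfold sinLoCoeffs
  rw [polyR_tabV, Finset.sum_range_succ]
  have h1 : ∑ k ∈ Finset.range n,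
      (((if k < n then (if 0 ≤ imIpowQ k then imIpowQ k * Llo ^ k / k.factorial
        else imIpowQ k * Lhi ^ k / k.factorial) else -(Lhi ^ n * expRemQ n) : ℚ) : ℚ) : ℝ) * h ^ k ≤
      ∑ k ∈ Finset.range n, ((imIpowQ k : ℚ) : ℝ) * (h * L) ^ k / k.factorial := by
    refine Finset.sum_le_sum fun k hk ↦ ?_
    rw [if_pos (Finset.mem_range.1 hk)]
    exact pick_lo_mul_le hL0 hL1 hL2 hh (imIpowQ k) k k.factorial
  have h2 : (((if n < n then (if 0 ≤ imIpowQ n then imIpowQ n * Llo ^ n / n.factorial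
        else imIpowQ n * Lhi ^ n / n.factorial) else -(Lhi ^ n * expRemQ n) : ℚ) : ℚ) : ℝ) * h ^ n ≤
      -(|h * L| ^ n * ((expRemQ n : ℚ) : ℝ)) := by
    rw [if_neg (lt_irrefl n)]
    have := abs_pow_mul_rem_le hL0 hL1 hL2 hh n
    push_cast at this ⊢
    linarith
  linarith [hmain.1]

/-- **Upper bracket of `sin`.** [folklore] -/
theorem sin_le_polyR_sinUp (hL0 : (0 : ℝ) ≤ Llo) (hL1 : (Llo : ℝ) ≤ L) (hL2 : L ≤ Lhi) (hh : 0 ≤ h)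
    (hhL : h * L ≤ 1) (hn : 0 < n) :
    Real.sin (h * L) ≤ polyR (sinUpCoeffs Llo Lhi n) h := by
  have hy : |h * L| ≤ 1 := by rw [abs_of_nonneg (mul_nonneg hh (hL0.trans hL1))]; exact hhL
  have hmain := abs_sin_sub_sum_le hy hn
  rw [abs_le] at hmain
  unfold sinUpCoeffs
  rw [polyR_tabV, Finset.sum_range_succ]
  have h1 : ∑ k ∈ Finset.range n, ((imIpowQ k : ℚ) : ℝ) * (h * L) ^ k / k.factorial ≤
      ∑ k ∈ Finset.range n,
      (((if k < n then (if 0 ≤ imIpowQ k then imIpowQ k * Lhi ^ k / k.factorial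
        else imIpowQ k * Llo ^ k / k.factorial) else Lhi ^ n * expRemQ n : ℚ) : ℚ) : ℝ) * h ^ k := by
    refine Finset.sum_le_sum fun k hk ↦ ?_
    rw [if_pos (Finset.mem_range.1 hk)]
    exact le_pick_hi_mul hL0 hL1 hL2 hh (imIpowQ k) k k.factorial
  have h2 : |h * L| ^ n * ((expRemQ n : ℚ) : ℝ) ≤
      (((if n < n then (if 0 ≤ imIpowQ n then imIpowQ n * Lhi ^ n / n.factorial
        else imIpowQ n * Llo ^ n / n.factorial) else Lhi ^ n * expRemQ n : ℚ) : ℚ) : ℝ) * h ^ n := by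
    rw [if_neg (lt_irrefl n)]
    exact abs_pow_mul_rem_le hL0 hL1 hL2 hh n
  linarith [hmain.2]

end TrigBrackets


end Literature.NumberTheory.LFunctions
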